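import Literature.AnabelianGeometry.AbsoluteAnabelian.MonoidKummerMapsEndQmodZ
import Literature.AnabelianGeometry.EtaleTheta.CyclotomeHomQmodZ
import HarnessLib

/-!
# [AbsTopIII] Def. 3.1 (v) «`μ_Ẑ(M) := Hom(ℚ/ℤ, M)`» — literally; and the coherence `Λ(ℚ/ℤ) ≅ Ẑ`

S. Mochizuki, *Topics in absolute anabelian geometry III*, Def. 3.1 (v) p. 69: for an MLF-Galois `T`-pair
`(Π ↷ M)`, «the cyclotome `μ_Ẑ(M) := Hom(ℚ/ℤ, M)`».  The tree REALISES it (abc-iut-L4-t2,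
`MLFGaloisModel.lean`) as `AbsoluteAnabelian.cyclotome M := EtaleTheta.cyclotome Mˣ = lim_n Mˣ[n]`, its
docstring promising «`Hom(ℚ/ℤ, M) = Hom(ℚ/ℤ, Mˣ) ≅ lim_n Mˣ[n]` canonically».  With
`EtaleTheta.cyclotome.homQmodZEquiv` (`CyclotomeHomQmodZ.lean`) both halves are now kernel objects:

* `homUnitsEquiv : Hom(ℚ/ℤ, M) ≃* Hom(ℚ/ℤ, Mˣ)` — a homomorphism out of the GROUP `ℚ/ℤ` into a commutative
  monoid takes unit values (Mathlib `MonoidHom.toHomUnits`);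
* `cyclotomeEquivHomQmodZ M : AbsoluteAnabelian.cyclotome M ≃* Hom(ℚ/ℤ, M)` — Def. 3.1 (v) verbatim for
  the tree's realisation, natural in monoid homomorphisms (`cyclotomeEquivHomQmodZ_symm_comp`);
* `cyclotomeQmodZEquivZHat : Λ(ℚ/ℤ) ≃* Ẑ` — coherence of the tree's two routes `Λ(ℚ/ℤ) ≅ Hom(ℚ/ℤ, ℚ/ℤ)
  = End(ℚ/ℤ) ≅ Ẑ` (`ZHatCompletion.endAddCircleEquiv`, `MonoidKummerMapsEndQmodZ.lean`; Prop. 3.2 (i)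
  p. 71 «applying the functor `Hom(ℚ/ℤ, −)`»), normalised by `η(k) ↦ (n ↦ (1/n)^k)`.

Construction + proof only; classical. HONEST FRAMING: nothing here bears on [IUTchIII] Cor. 3.12; no side taken.
-/

noncomputable section

open CategoryTheory ProfiniteGrp ProfiniteGrp.ProfiniteCompletion

namespace Literature.AnabelianGeometry.AbsoluteAnabelian

open EtaleTheta

universe u

/-! ### Def. 3.1 (v): `μ_Ẑ(M) = Hom(ℚ/ℤ, M)` for the tree's `cyclotome M = Λ(Mˣ)` -/

section DefCyclotome

variable (M : Type u) [CommMonoid M]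

/-- A homomorphism from the group `ℚ/ℤ` to a commutative monoid `M` takes values in `Mˣ`:
`Hom(ℚ/ℤ, M) ≃* Hom(ℚ/ℤ, Mˣ)` (Mathlib `MonoidHom.toHomUnits` / `Units.coeHom`).
[cite: MochizukiAbsTopIII2015, Definition 3.1 (v) p.69] -/
def homUnitsEquiv :
    (Multiplicative (AddCircle (1 : ℚ)) →* M) ≃* (Multiplicative (AddCircle (1 : ℚ)) →* Mˣ) where
  toFun φ := φ.toHomUnits
  invFun ψ := (Units.coeHom M).comp ψ
  left_inv _ := MonoidHom.ext fun _ => rfl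
  right_inv _ := MonoidHom.ext fun _ => Units.ext rfl
  map_mul' _ _ := MonoidHom.ext fun _ => Units.ext rfl

/-- Values of `homUnitsEquiv`. [cite: MochizukiAbsTopIII2015, Definition 3.1 (v) p.69] -/
@[simp] theorem coe_homUnitsEquiv_apply (φ : Multiplicative (AddCircle (1 : ℚ)) →* M)
    (u : Multiplicative (AddCircle (1 : ℚ))) : ((homUnitsEquiv M φ u : Mˣ) : M) = φ u := rfl

/-- **Def. 3.1 (v) «`μ_Ẑ(M) := Hom(ℚ/ℤ, M)`», literally**: the tree's realisation
`cyclotome M = Λ(Mˣ) = lim_n Mˣ[n]` identified with `Hom(ℚ/ℤ, M)` (composite of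
`EtaleTheta.cyclotome.homQmodZEquiv.symm` and `homUnitsEquiv.symm`). CONSTRUCTED.
[cite: MochizukiAbsTopIII2015, Definition 3.1 (v) p.69] -/
def cyclotomeEquivHomQmodZ : cyclotome M ≃* (Multiplicative (AddCircle (1 : ℚ)) →* M) :=
  (cyclotome.homQmodZEquiv (A := Mˣ)).symm.trans (homUnitsEquiv M).symm

variable {M}

/-- `cyclotomeEquivHomQmodZ M ζ` at `1/n` is the `n`-th component of `ζ`.
[cite: MochizukiAbsTopIII2015, Definition 3.1 (v) p.69] -/
@[simp] theorem cyclotomeEquivHomQmodZ_apply_ofAdd_inv (ζ : cyclotome M) (n : ℕ+) :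
    cyclotomeEquivHomQmodZ M ζ (Multiplicative.ofAdd ((((1 : ℚ) / (n : ℕ) : ℚ) : AddCircle (1 : ℚ)))) =
      (((ζ : ℕ+ → Mˣ) n : Mˣ) : M) := by
  change ((cyclotome.homQmodZEquiv (A := Mˣ)).symm ζ _ : M) = _
  rw [cyclotome.homQmodZEquiv_symm_apply, cyclotome.toHom_ofAdd_inv]

/-- The inverse: `φ : ℚ/ℤ → M` goes to the compatible family `(φ(1/n))_n` of units.
[cite: MochizukiAbsTopIII2015, Definition 3.1 (v) p.69] -/
@[simp] theorem coe_cyclotomeEquivHomQmodZ_symm_apply (φ : Multiplicative (AddCircle (1 : ℚ)) →* M)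
    (n : ℕ+) :
    ((((cyclotomeEquivHomQmodZ M).symm φ : cyclotome M) : ℕ+ → Mˣ) n : M) =
      φ (Multiplicative.ofAdd ((((1 : ℚ) / (n : ℕ) : ℚ) : AddCircle (1 : ℚ)))) := rfl

/-- **Naturality of Def. 3.1 (v)** in monoid homomorphisms `f : M →* N`: `μ_Ẑ(f) = Λ(fˣ)` corresponds to
post-composition `φ ↦ f ∘ φ` on `Hom(ℚ/ℤ, −)`. [cite: MochizukiAbsTopIII2015, Definition 3.1 (v) p.69] -/
theorem cyclotomeEquivHomQmodZ_symm_comp {N : Type u} [CommMonoid N] (f : M →* N)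
    (φ : Multiplicative (AddCircle (1 : ℚ)) →* M) :
    (cyclotomeEquivHomQmodZ N).symm (f.comp φ) =
      cyclotome.map (Units.map f) ((cyclotomeEquivHomQmodZ M).symm φ) :=
  Subtype.ext (funext fun _ => Units.ext rfl)

end DefCyclotome

/-! ### Coherence: `Λ(ℚ/ℤ) ≅ End(ℚ/ℤ) ≅ Ẑ` -/

/-- `Hom(ℚ/ℤ, ℚ/ℤ)` read multiplicatively is `End(ℚ/ℤ)` read multiplicatively.
[cite: MochizukiAbsTopIII2015, Proposition 3.2 (i) p.71] -/
def endAddCircleMulEquiv :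
    (Multiplicative (AddCircle (1 : ℚ)) →* Multiplicative (AddCircle (1 : ℚ))) ≃*
      Multiplicative (AddCircle (1 : ℚ) →+ AddCircle (1 : ℚ)) where
  toFun φ := Multiplicative.ofAdd (AddMonoidHom.toMultiplicative.symm φ)
  invFun ψ := AddMonoidHom.toMultiplicative (Multiplicative.toAdd ψ)
  left_inv φ := AddMonoidHom.toMultiplicative.apply_symm_apply φ
  right_inv _ := congrArg Multiplicative.ofAdd (AddMonoidHom.toMultiplicative.symm_apply_apply _)
  map_mul' _ _ := rfl

/-- **`Λ(ℚ/ℤ) ≅ Ẑ`**: the tree's inverse-limit cyclotome of `ℚ/ℤ` IS Mathlib's profinite completion of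
`ℤ` — composite `Λ(ℚ/ℤ) ≅ Hom(ℚ/ℤ, ℚ/ℤ) = End(ℚ/ℤ) ≅ Ẑ` of `cyclotome.homQmodZEquiv` and
`ZHatCompletion.endAddCircleEquiv`. CONSTRUCTED. [cite: MochizukiAbsTopIII2015, Proposition 3.2 (i) p.71] -/
def cyclotomeQmodZEquivZHat :
    EtaleTheta.cyclotome (Multiplicative (AddCircle (1 : ℚ))) ≃* completion (GrpCat.of (Multiplicative ℤ)) :=
  (cyclotome.homQmodZEquiv (A := Multiplicative (AddCircle (1 : ℚ)))).symm.trans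
    (endAddCircleMulEquiv.trans (AddEquiv.toMultiplicativeLeft ZHatCompletion.endAddCircleEquiv))

/-- **Normalisation** of `Λ(ℚ/ℤ) ≅ Ẑ`: `η(k) ∈ Ẑ` corresponds to the compatible family `(k/n)_n`, i.e.
`n ↦ (1/n)^k`. [cite: MochizukiAbsTopIII2015, Proposition 3.2 (i) p.71] -/
theorem cyclotomeQmodZEquivZHat_symm_etaFn_coe (k : ℤ) (n : ℕ+) :
    ((cyclotomeQmodZEquivZHat.symm (etaFn (GrpCat.of (Multiplicative ℤ)) (Multiplicative.ofAdd k)) :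
        EtaleTheta.cyclotome (Multiplicative (AddCircle (1 : ℚ)))) : ℕ+ → Multiplicative (AddCircle (1 : ℚ))) n =
      Multiplicative.ofAdd ((((1 : ℚ) / (n : ℕ) : ℚ) : AddCircle (1 : ℚ))) ^ k := by
  change ((cyclotome.homQmodZEquiv (A := Multiplicative (AddCircle (1 : ℚ))) (endAddCircleMulEquiv.symm
      ((AddEquiv.toMultiplicativeLeft ZHatCompletion.endAddCircleEquiv).symm
        (etaFn (GrpCat.of (Multiplicative ℤ)) (Multiplicative.ofAdd k)))) :
          EtaleTheta.cyclotome (Multiplicative (AddCircle (1 : ℚ)))) : ℕ+ → Multiplicative (AddCircle (1 : ℚ))) n = _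
  rw [cyclotome.homQmodZEquiv_apply_coe]
  change Multiplicative.ofAdd (ZHatCompletion.toEnd (etaFn (GrpCat.of (Multiplicative ℤ))
    (Multiplicative.ofAdd k)) ((((1 : ℚ) / (n : ℕ) : ℚ) : AddCircle (1 : ℚ)))) = _
  rw [ZHatCompletion.toEnd_etaFn, ofAdd_zsmul]

end Literature.AnabelianGeometry.AbsoluteAnabelian

end
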